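import Summits.Ventures.HSemireg.WedgeHankelRecurrenceGaussChebyshevTangentBounds

/-!
# Venture HSemireg — **VIÈTE'S NESTED RADICALS AS A `C_2`-ORBIT: with `s_n(x) = √(2 + √(2 + ⋯ + √(2 + x)))` (`n` roots; Mathlib `Real.sqrtTwoAddSeries x n`), `C_2(s_{n+1}) = s_n`, `C_{2^k}(s_{n+k}) = s_n` (`x ≥ 0`),
# hence `C_{2^n}(s_n(0)) = 0`, `C_{2^{n+1}}(s_n(0)) = −2`, `C_{2^{n+2+j}}(s_n(0)) = 2` (the orbit `s_n ↦ s_{n−1} ↦ ⋯ ↦ √2 ↦ 0 ↦ −2 ↦ 2 ↦ 2 ↦ ⋯` of the doubling map `C_2 = X² − 2`), and `C_m(s_n(0)) = 2cos(mπ∕2^{n+1})`**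

HONEST FRAMING. Part of the Lean index of the computation cell `pub-hsemireg` (seat p10 gen 49, Sunday typer «UNIFORM-IN-n»).  Real algebra and trigonometry (Mathlib `Real.sqrtTwoAddSeries`, `Real.cos`,
`Polynomial.Chebyshev.C`); no variety, no cohomology theory, no sheaf, no Ext group and no semiregularity map is constructed here; nothing here says that HC / HC_CM / HC_AV holds; no Literature fact (unproved
`Prop`) is declared or used.  Custodian versions as in `WedgeHankelSiegelIdeal` (1/3).
SOURCES (cited).  F. Viète, *Variorum de rebus mathematicis responsorum liber VIII* (1593) (`2∕π = √½·√(½+½√½)⋯`); T. J. Rivlin, *The Chebyshev Polynomials* (Wiley 1974), §1.1 and Ch. 4 (`T_2` as the doubling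
map, `T_m ∘ T_n = T_{mn}`); L. D. Servi, *Nested square roots of 2*, Amer. Math. Monthly 110 (2003) 326–330.
PROOF TYPED HERE.  `C_2 = X² − 2` (Mathlib `C_two`) and `(√(2 + s))² = 2 + s` for `s ≥ 0` (`Real.sq_sqrt`, `sqrtTwoAddSeries_nonneg`); `C_{2m} = C_m ∘ C_2` (Mathlib `C_mul`) and induction on `k`; `C_2(0) = −2`,
`C_2(−2) = 2`, `C_2(2) = 2`; `s_n(0) = 2cos(π∕2^{n+1})` (Mathlib `cos_pi_over_two_pow`) and `C_m(2cos θ) = 2cos(mθ)` (`C_two_mul_real_cos`).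
DEDUP DISCLOSURE (`rg -ln sqrtTwoAddSeries Summits Literature` — only `Summits/Ventures/CertifiedToolchain/TMD/Common/Pi.lean` (π enclosures, unrelated), 2026-09-05): Mathlib has `cos_pi_over_two_pow`,
`sqrtTwoAddSeries_*` and the `π` bounds built on them, and `C_mul` ∕ `T_mul` (composition); `Literature.Algebra.Polynomial.ChebyshevChains ∕ ChebyshevPSets ∕ ChebyshevPermutable` treat commuting chains
abstractly; the evaluation of `C_2 ∕ C_{2^k} ∕ C_m` at the nested radicals is not typed; 0 hits for the 7 names below.

WHAT IS IN THE TREE.  Mathlib `Real.sqrtTwoAddSeries`, `sqrtTwoAddSeries_nonneg`, `Real.sq_sqrt`, `cos_pi_over_two_pow`, `Polynomial.Chebyshev.C_two`, `C_mul`, `C_two_mul_real_cos`.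
THIS FILE (namespace `Summit.Ventures.HSemireg.Wedge.HankelOuter` continued; CHAINED on N555; 0 definitions):
* §1321 **`chebyshevC_two_eval_sqrtTwoAddSeries_succ`** (`C_2(s_{n+1}(x)) = s_n(x)`, `x ≥ 0`), **`chebyshevC_two_pow_eval_sqrtTwoAddSeries_add`** (`C_{2^k}(s_{n+k}(x)) = s_n(x)`),
  **`chebyshevC_two_pow_eval_sqrtTwoAddSeries_zero`** (`C_{2^n}(s_n(0)) = 0`), **`chebyshevC_two_pow_succ_eval_sqrtTwoAddSeries_zero`** (`= −2`), **`chebyshevC_two_pow_add_two_eval_sqrtTwoAddSeries_zero`** (`= 2`),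
  `sqrtTwoAddSeries_zero_eq_two_mul_cos` (`s_n(0) = 2cos(π∕2^{n+1})`, Mathlib rearranged), **`chebyshevC_eval_sqrtTwoAddSeries_zero`** (`C_m(s_n(0)) = 2cos(mπ∕2^{n+1})`, all `m ∈ ℤ`).
CAVEATS.  `x ≥ 0` in the orbit statements (so that every radicand is `≥ 2`).  Nothing Ext-side.  New names only.
-/

open Module Polynomial
open scoped Matrix Polynomial

namespace Summit.Ventures.HSemireg.Wedge.HankelOuter

/-! ## §1321. Nested radicals and the doubling map `C_2` -/

/-- **`C_2(s_{n+1}(x)) = s_n(x)`** for `x ≥ 0`, where `s_n = Real.sqrtTwoAddSeries x n` (`C_2 = X² − 2` undoes one square root). [Servi 2003; this file, §1321] -/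
theorem chebyshevC_two_eval_sqrtTwoAddSeries_succ {x : ℝ} (hx : 0 ≤ x) (n : ℕ) :
    (Polynomial.Chebyshev.C ℝ 2).eval (Real.sqrtTwoAddSeries x (n + 1)) = Real.sqrtTwoAddSeries x n := by
  rw [Polynomial.Chebyshev.C_two, eval_sub, eval_pow, eval_X, eval_ofNat, Real.sqrtTwoAddSeries,
    Real.sq_sqrt (by linarith [Real.sqrtTwoAddSeries_nonneg hx n])]
  ring

/-- **`C_{2^k}(s_{n+k}(x)) = s_n(x)`** for `x ≥ 0` (`C_{2^{k+1}} = C_{2^k} ∘ C_2`, Mathlib `C_mul`). [Rivlin 1974, Ch. 4; this file, §1321] -/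
theorem chebyshevC_two_pow_eval_sqrtTwoAddSeries_add {x : ℝ} (hx : 0 ≤ x) (n k : ℕ) :
    (Polynomial.Chebyshev.C ℝ ((2 ^ k : ℕ) : ℤ)).eval (Real.sqrtTwoAddSeries x (n + k)) = Real.sqrtTwoAddSeries x n := by
  induction k with
  | zero => simp
  | succ k ih =>
    rw [show (((2 ^ (k + 1) : ℕ)) : ℤ) = ((2 ^ k : ℕ) : ℤ) * 2 by push_cast; ring, Polynomial.Chebyshev.C_mul, eval_comp, show n + (k + 1) = (n + k) + 1 by ring,
      chebyshevC_two_eval_sqrtTwoAddSeries_succ hx, ih]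

/-- **`C_{2^n}(s_n(0)) = 0`** (`n` applications of the doubling map bring `√(2+√(2+⋯))` to `s_0 = 0`). [this file, §1321] -/
theorem chebyshevC_two_pow_eval_sqrtTwoAddSeries_zero (n : ℕ) : (Polynomial.Chebyshev.C ℝ ((2 ^ n : ℕ) : ℤ)).eval (Real.sqrtTwoAddSeries 0 n) = 0 := by
  have h := chebyshevC_two_pow_eval_sqrtTwoAddSeries_add le_rfl 0 n
  rwa [zero_add, Real.sqrtTwoAddSeries_zero] at h

/-- **`C_{2^{n+1}}(s_n(0)) = −2`** (one more doubling: `C_2(0) = −2`). [this file, §1321] -/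
theorem chebyshevC_two_pow_succ_eval_sqrtTwoAddSeries_zero (n : ℕ) : (Polynomial.Chebyshev.C ℝ ((2 ^ (n + 1) : ℕ) : ℤ)).eval (Real.sqrtTwoAddSeries 0 n) = -2 := by
  rw [show (((2 ^ (n + 1) : ℕ)) : ℤ) = 2 * ((2 ^ n : ℕ) : ℤ) by push_cast; ring, Polynomial.Chebyshev.C_mul, eval_comp, chebyshevC_two_pow_eval_sqrtTwoAddSeries_zero,
    Polynomial.Chebyshev.C_two]
  norm_num

/-- **`C_{2^{n+2+j}}(s_n(0)) = 2`** for all `j` (then the orbit is fixed: `C_2(−2) = 2 = C_2(2)`). [this file, §1321] -/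
theorem chebyshevC_two_pow_add_two_eval_sqrtTwoAddSeries_zero (n j : ℕ) : (Polynomial.Chebyshev.C ℝ ((2 ^ (n + 2 + j) : ℕ) : ℤ)).eval (Real.sqrtTwoAddSeries 0 n) = 2 := by
  induction j with
  | zero =>
    rw [add_zero, show (((2 ^ (n + 2) : ℕ)) : ℤ) = 2 * ((2 ^ (n + 1) : ℕ) : ℤ) by push_cast; ring, Polynomial.Chebyshev.C_mul, eval_comp,
      chebyshevC_two_pow_succ_eval_sqrtTwoAddSeries_zero, Polynomial.Chebyshev.C_two]
    norm_num
  | succ j ih =>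
    rw [show (((2 ^ (n + 2 + (j + 1)) : ℕ)) : ℤ) = 2 * ((2 ^ (n + 2 + j) : ℕ) : ℤ) by push_cast; ring, Polynomial.Chebyshev.C_mul, eval_comp, ih, Polynomial.Chebyshev.C_two]
    norm_num

/-- `s_n(0) = 2cos(π∕2^{n+1})` (Mathlib `cos_pi_over_two_pow`, rearranged). [Viète 1593; this file, §1321] -/
theorem sqrtTwoAddSeries_zero_eq_two_mul_cos (n : ℕ) : Real.sqrtTwoAddSeries 0 n = 2 * Real.cos (Real.pi / 2 ^ (n + 1)) := by
  rw [Real.cos_pi_over_two_pow n]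
  ring

/-- **`C_m(s_n(0)) = 2cos(mπ∕2^{n+1})`** for every `m ∈ ℤ` (the nested radical is `2cos(π∕2^{n+1})`). [Viète 1593; Rivlin 1974, §1.1; this file, §1321] -/
theorem chebyshevC_eval_sqrtTwoAddSeries_zero (m : ℤ) (n : ℕ) :
    (Polynomial.Chebyshev.C ℝ m).eval (Real.sqrtTwoAddSeries 0 n) = 2 * Real.cos (m * (Real.pi / 2 ^ (n + 1))) := by
  rw [sqrtTwoAddSeries_zero_eq_two_mul_cos, Polynomial.Chebyshev.C_two_mul_real_cos]

end Summit.Ventures.HSemireg.Wedge.HankelOuter
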